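import Mathlib
import Summits.Ventures.PercRepro2.Defs
import Summits.Ventures.PercRepro2.Graph
import Summits.Ventures.PercRepro2.Events
import Summits.Ventures.PercRepro2.Harris
import Summits.Ventures.PercRepro2.XWForm

/-!
# The Harris split of the cross W-form (PercRepro2, p2 g25)

With `a = {s ↔ u}`, `λ = {y ↔ o}`, `S = {s ↔ y}`, `Q = Sᶜ`, write the eight cells
`q_ij = P(Q, a = i, λ = j)`, `s_ij = P(S, a = i, λ = j)`.  The slack of (XW) is the
«cross odds» form `XW = q₀₀s₁₁ + q₁₁s₀₀ + q₀₀q₁₁ − q₁₀s₀₁ − q₀₁s₁₀ − q₁₀q₀₁`, which splits as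

* `harrisPart = q₀₀·P(aλ) − q₁₀·P(¬a λ) = P(Q¬λ)·P(aλ) − P(Qa¬λ)·P(λ)`, **nonnegative by Harris
  alone** (`harrisPart_nonneg`): it says `P(a | λ) ≥ P(a) ≥ P(a | Q¬λ)` — `a`, `λ` increasing and
  `Q¬λ` decreasing;
* `residualPart = q₁₁·s₀₀ − q₀₁·s₁₀ = P(Qaλ)·P(S¬a¬λ) − P(Q¬aλ)·P(Sa¬λ)`, the part that carries
  the content of (XW) (it is negative on most instances; (XW) says it is bounded below by
  `−harrisPart`).

`xwBil_eq_harrisPart_add_residualPart` is pure algebra from `P(X ∩ S) + P(X ∩ Sᶜ) = P(X)` and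
`P(univ) = 1`; consequently `residualPart ≤ XW` (`residualPart_le_xwBil`) and (XW) holds whenever
the residual is nonnegative (`xwBil_nonneg_of_residualPart_nonneg`).  Own work (record
proofs/P2-G25-XWSTRUCT.md); standard axioms.
-/

namespace Summit.Ventures.PercRepro2

namespace XWSplit

variable {V : Type*} {E : Type*} [Fintype E] [DecidableEq E]
  {R : Type*} [CommRing R] [LinearOrder R] [IsStrictOrderedRing R]

omit [LinearOrder R] [IsStrictOrderedRing R] in
/-- **The Harris part** `P(Q ∩ λᶜ)·P(a ∩ λ) − P(Q ∩ a ∩ λᶜ)·P(λ)` of the cross odds form. -/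
noncomputable def harrisPart (ends : E → Sym2 V) (s y o u : V) (p : E → R) : R :=
  prob p ((connEvent ends s y)ᶜ ∩ (connEvent ends y o)ᶜ) *
      prob p (connEvent ends s u ∩ connEvent ends y o) -
    prob p ((connEvent ends s y)ᶜ ∩ connEvent ends s u ∩ (connEvent ends y o)ᶜ) *
      prob p (connEvent ends y o)

omit [LinearOrder R] [IsStrictOrderedRing R] in
/-- **The residual part** `P(Q ∩ a ∩ λ)·P(S ∩ aᶜ ∩ λᶜ) − P(Q ∩ aᶜ ∩ λ)·P(S ∩ a ∩ λᶜ)`. -/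
noncomputable def residualPart (ends : E → Sym2 V) (s y o u : V) (p : E → R) : R :=
  prob p ((connEvent ends s y)ᶜ ∩ connEvent ends s u ∩ connEvent ends y o) *
      prob p (connEvent ends s y ∩ (connEvent ends s u)ᶜ ∩ (connEvent ends y o)ᶜ) -
    prob p ((connEvent ends s y)ᶜ ∩ (connEvent ends s u)ᶜ ∩ connEvent ends y o) *
      prob p (connEvent ends s y ∩ connEvent ends s u ∩ (connEvent ends y o)ᶜ)

omit [LinearOrder R] [IsStrictOrderedRing R] in
/-- **The split** `XW = harrisPart + residualPart` (the cross odds form of (XW)). -/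
theorem xwBil_eq_harrisPart_add_residualPart (ends : E → Sym2 V) (s y o u : V) (p : E → R) :
    xwBil ends s y o u p p = harrisPart ends s y o u p + residualPart ends s y o u p := by
  unfold xwBil harrisPart residualPart
  set S := connEvent ends s y with hS
  set a := connEvent ends s u with ha
  set l := connEvent ends y o with hl
  -- the eight cells
  have f1 : prob p (S ∩ a ∩ l) + prob p (S ∩ a ∩ lᶜ) = prob p (S ∩ a) :=
    prob_inter_add_prob_inter_compl p (S ∩ a) l
  have f2 : prob p (S ∩ aᶜ ∩ l) + prob p (S ∩ aᶜ ∩ lᶜ) = prob p (S ∩ aᶜ) :=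
    prob_inter_add_prob_inter_compl p (S ∩ aᶜ) l
  have f3 : prob p (S ∩ a) + prob p (S ∩ aᶜ) = prob p S := prob_inter_add_prob_inter_compl p S a
  have f4 : prob p (Sᶜ ∩ a ∩ l) + prob p (Sᶜ ∩ a ∩ lᶜ) = prob p (Sᶜ ∩ a) :=
    prob_inter_add_prob_inter_compl p (Sᶜ ∩ a) l
  have f5 : prob p (Sᶜ ∩ aᶜ ∩ l) + prob p (Sᶜ ∩ aᶜ ∩ lᶜ) = prob p (Sᶜ ∩ aᶜ) :=
    prob_inter_add_prob_inter_compl p (Sᶜ ∩ aᶜ) l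
  have f6 : prob p (Sᶜ ∩ a) + prob p (Sᶜ ∩ aᶜ) = prob p Sᶜ :=
    prob_inter_add_prob_inter_compl p Sᶜ a
  have f7 : prob p Sᶜ = 1 - prob p S := prob_compl p S
  -- the seven quantities of `xwBil` and the two extra ones of `harrisPart`
  have g1 : prob p (a ∩ l) = prob p (S ∩ a ∩ l) + prob p (Sᶜ ∩ a ∩ l) := by
    have h := prob_inter_add_prob_inter_compl p (a ∩ l) S
    have e1 : a ∩ l ∩ S = S ∩ a ∩ l := by
      ext x; simp only [Set.mem_inter_iff]; tauto
    have e2 : a ∩ l ∩ Sᶜ = Sᶜ ∩ a ∩ l := by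
      ext x; simp only [Set.mem_inter_iff, Set.mem_compl_iff]; tauto
    rw [e1, e2] at h
    linear_combination -h
  have g2 : prob p a = prob p (S ∩ a) + prob p (Sᶜ ∩ a) := by
    have h := prob_inter_add_prob_inter_compl p a S
    rw [Set.inter_comm a S, Set.inter_comm a Sᶜ] at h
    linear_combination -h
  have g3 : prob p l = prob p (S ∩ a ∩ l) + prob p (S ∩ aᶜ ∩ l) + prob p (Sᶜ ∩ a ∩ l) +
      prob p (Sᶜ ∩ aᶜ ∩ l) := by
    have h := prob_inter_add_prob_inter_compl p l S
    have h1 := prob_inter_add_prob_inter_compl p (l ∩ S) a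
    have h2 := prob_inter_add_prob_inter_compl p (l ∩ Sᶜ) a
    have e1 : l ∩ S ∩ a = S ∩ a ∩ l := by
      ext x; simp only [Set.mem_inter_iff]; tauto
    have e2 : l ∩ S ∩ aᶜ = S ∩ aᶜ ∩ l := by
      ext x; simp only [Set.mem_inter_iff, Set.mem_compl_iff]; tauto
    have e3 : l ∩ Sᶜ ∩ a = Sᶜ ∩ a ∩ l := by
      ext x; simp only [Set.mem_inter_iff, Set.mem_compl_iff]; tauto
    have e4 : l ∩ Sᶜ ∩ aᶜ = Sᶜ ∩ aᶜ ∩ l := by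
      ext x; simp only [Set.mem_inter_iff, Set.mem_compl_iff]; tauto
    rw [e1, e2] at h1
    rw [e3, e4] at h2
    linear_combination -h - h1 - h2
  have g4 : prob p (S ∩ l) = prob p (S ∩ a ∩ l) + prob p (S ∩ aᶜ ∩ l) := by
    have h := prob_inter_add_prob_inter_compl p (S ∩ l) a
    have e1 : S ∩ l ∩ a = S ∩ a ∩ l := by
      ext x; simp only [Set.mem_inter_iff]; tauto
    have e2 : S ∩ l ∩ aᶜ = S ∩ aᶜ ∩ l := by
      ext x; simp only [Set.mem_inter_iff, Set.mem_compl_iff]; tauto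
    rw [e1, e2] at h
    linear_combination -h
  have g5 : prob p (Sᶜ ∩ lᶜ) = prob p (Sᶜ ∩ a ∩ lᶜ) + prob p (Sᶜ ∩ aᶜ ∩ lᶜ) := by
    have h := prob_inter_add_prob_inter_compl p (Sᶜ ∩ lᶜ) a
    have e1 : Sᶜ ∩ lᶜ ∩ a = Sᶜ ∩ a ∩ lᶜ := by
      ext x; simp only [Set.mem_inter_iff, Set.mem_compl_iff]; tauto
    have e2 : Sᶜ ∩ lᶜ ∩ aᶜ = Sᶜ ∩ aᶜ ∩ lᶜ := by
      ext x; simp only [Set.mem_inter_iff, Set.mem_compl_iff]; tauto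
    rw [e1, e2] at h
    linear_combination -h
  rw [g1, g2, g3, g4, g5, ← f3, ← f1, ← f2, ← f4]
  have hsum : prob p (S ∩ a ∩ l) + prob p (S ∩ a ∩ lᶜ) + prob p (S ∩ aᶜ ∩ l) +
      prob p (S ∩ aᶜ ∩ lᶜ) + prob p (Sᶜ ∩ a ∩ l) + prob p (Sᶜ ∩ a ∩ lᶜ) + prob p (Sᶜ ∩ aᶜ ∩ l) +
      prob p (Sᶜ ∩ aᶜ ∩ lᶜ) = 1 := by
    linear_combination f1 + f2 + f3 + f4 + f5 + f6 + f7
  linear_combination (-(prob p (Sᶜ ∩ a ∩ l) + prob p (S ∩ a ∩ l))) * hsum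

/-- **The Harris part is nonnegative**: `P(Q¬λ)·P(aλ) ≥ P(Q¬λ)·P(a)·P(λ) ≥ P(Qa¬λ)·P(λ)`
(Harris for the increasing `a`, `λ`, and for the decreasing `Q ∩ λᶜ` against `a`). -/
theorem harrisPart_nonneg (ends : E → Sym2 V) (s y o u : V) {p : E → R} (hp : IsProbVec p) :
    0 ≤ harrisPart ends s y o u p := by
  unfold harrisPart
  set S := connEvent ends s y with hS
  set a := connEvent ends s u with ha
  set l := connEvent ends y o with hl
  have hD : IsLowerSet (Sᶜ ∩ lᶜ) :=
    (isUpperSet_connEvent ends s y).compl.inter (isUpperSet_connEvent ends y o).compl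
  have h1 : prob p a * prob p l ≤ prob p (a ∩ l) :=
    prob_mul_prob_le_prob_inter hp (isUpperSet_connEvent ends s u) (isUpperSet_connEvent ends y o)
  have h2 : prob p ((Sᶜ ∩ lᶜ) ∩ a) ≤ prob p (Sᶜ ∩ lᶜ) * prob p a :=
    prob_inter_le_prob_mul_prob_of_isLowerSet hp hD (isUpperSet_connEvent ends s u)
  have e : Sᶜ ∩ lᶜ ∩ a = Sᶜ ∩ a ∩ lᶜ := by
    ext x; simp only [Set.mem_inter_iff, Set.mem_compl_iff]; tauto
  rw [e] at h2
  have hD0 : 0 ≤ prob p (Sᶜ ∩ lᶜ) := prob_nonneg hp _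
  have hl0 : 0 ≤ prob p l := prob_nonneg hp _
  nlinarith [mul_le_mul_of_nonneg_left h1 hD0, mul_le_mul_of_nonneg_right h2 hl0]

/-- `residualPart ≤ XW`: the content of (XW) sits in the residual. -/
theorem residualPart_le_xwBil (ends : E → Sym2 V) (s y o u : V) {p : E → R} (hp : IsProbVec p) :
    residualPart ends s y o u p ≤ xwBil ends s y o u p p := by
  rw [xwBil_eq_harrisPart_add_residualPart]
  have := harrisPart_nonneg ends s y o u hp
  linarith

/-- **(XW) whenever the residual is nonnegative**, in particular whenever
`P(Q¬aλ)·P(Sa¬λ) ≤ P(Qaλ)·P(S¬a¬λ)`. -/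
theorem xwBil_nonneg_of_residualPart_nonneg (ends : E → Sym2 V) (s y o u : V) {p : E → R}
    (hp : IsProbVec p) (h : 0 ≤ residualPart ends s y o u p) :
    0 ≤ xwBil ends s y o u p p :=
  h.trans (residualPart_le_xwBil ends s y o u hp)

end XWSplit

end Summit.Ventures.PercRepro2
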